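import Summits.CriticalPhenomena.PercolationContinuityZ3.Theorems.PercNearOneGluingNoHeavyQuantTargetPropertyAt
import Literature.Probability.Percolation.KozmaNitzanCorridor
import HarnessLib

/-!
# QUANT lane (R2, step S3b): Kozma–Nitzan's Lemma 12 (the corridor lemma) with LINEAR bookkeeping

builds on p205010 (kernel theorem, internal audit signed; external expert review pending)

Cell `prim-quant` (post-continuity programme, LANE 1), seat `prim-quant-p2` (METHOD = effective Kozma–Nitzan
reduction), memo `run/shared/lean/prim/quant/P2-EFFECTIVE-KN.md` §2 (L12-add), Lean step S3b.

The tree's Lemma 12 (`KozmaNitzan.CData.corridorLemma_of_target`, `…/KozmaNitzanCorridor.lean`) applies the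
target property `d + 1` times (`halvingChain_of_target`: `d` halving steps with the quarter faces; `corridorStep`:
one step with the aspect-`88` elongated geometries), nesting the tolerances.  From LINEAR families of target
properties (`∀ δ', TargetPropertyAt d p (δ' + η) δ' H R₀`, which additive gluing delivers:
`Quant.targetPropertyAt_linear_of_scales`) the same geometry ADDS the losses:

* `Quant.halvingStep_linear`, `Quant.halvingChain_linear` — `n` halving steps cost `n·η`;
* `Quant.corridorStep_linear` — the corridor step costs `η'` (family for `elongList d 88`, margin `R₀'`);
* `Quant.corridorLemma_linear` — Lemma 12 with explicit scale threshold `r ≥ 100(d+1)(max R₀ R₀' + 1)` and loss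
  `d·η + η'`: `1 − δ' < P_W(o ↔ c + [-3r,3r]^d in A) ⟹ 1 − (δ' + d·η + η') < P_W(o ↔ c' + [-3r,3r]^d in U)`.

No `TargetProperty`, no `IsHittable`, no `θ(p) > 0`: the inputs are the two linear families, whose margins `R₀`,
`R₀'` are explicit once the scales are (memo §2).  No definitions; no sorries; standard axioms.
[cite: KozmaNitzan2024, §4 Lemma 12 (pp. 23–25)]
-/

noncomputable section

namespace Summit.CriticalPhenomena.PercolationContinuityZ3.Theorems.Quant

open MeasureTheory Literature.Probability.LatticeModels Literature.Probability.Percolation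
  Literature.Probability.Percolation.KozmaNitzan

variable {d : ℕ}

/-- **One halving step, linear form** (tree `CData.halvingStep_of_target`, same geometric inputs): with a linear
family of target properties for the quarter faces (margin `R₀`, loss `η`), reaching `B_k` from `o` in the
weighting restricted to `A` with probability `> 1 − δ'` forces reaching `B_{k+1}` with probability `> 1 − (δ' + η)`.
builds on p205010 (kernel theorem, internal audit signed; external expert review pending).
[cite: KozmaNitzan2024, §4 p. 24] -/
theorem halvingStep_linear [NeZero d] (p : unitInterval) {η : ℝ} {R₀ : ℕ}
    (hT : ∀ δ' : ℝ, TargetPropertyAt d p (δ' + η) δ' (qfList d) R₀)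
    (S : CData d) (hS : S.Hyp p) (k R : ℕ) (hk : k < d) (hR : R₀ ≤ R) (hRlh : R₀ ≤ S.lh)
    (hfit : ((S.r + 1) / 2 : ℕ) + (k : ℤ) * R + R ≤ S.r) {δ' : ℝ}
    (hB : 1 - δ' < (prodBernoulli (restrW (↑S.Aset : Set (Site d)) S.W)).real (⋃ b ∈ S.Bk k R, openConn S.o b)) :
    1 - (δ' + η) < (prodBernoulli (restrW (↑S.Aset : Set (Site d)) S.W)).real
      (⋃ b ∈ S.Bk (k + 1) R, openConn S.o b) := by
  have hR' : (R₀ : ℤ) ≤ R := by exact_mod_cast hR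
  have hfit0 : ((S.r + 1) / 2 : ℕ) + (k : ℤ) * R + R₀ ≤ S.r := by linarith
  have hkR : (k : ℤ) * R + R₀ ≤ 2 * S.r := by
    have : (0 : ℤ) ≤ ((S.r + 1) / 2 : ℕ) := by positivity
    linarith
  have hkR1 : ((k + 1 : ℕ) : ℤ) * R ≤ 2 * S.r := by push_cast; linarith
  exact hT δ' (restrW (↑S.Aset : Set (Site d)) S.W) S.Aset S.nearQ (S.c - S.hwid k R) (S.c + S.hwid k R)
    (S.Bk (k + 1) R) S.o (finSupp_restrW S.Aset S.W)
    ((CData.isSubbox_nearQ hS).restrW (Finset.coe_subset.2 (CData.nearQ_subset_Aset hS)))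
    (CData.nearQ_subset_Aset hS) (CData.o_mem_Aset hS) (CData.o_not_mem_nearQ hS) (S.enlarge_Bk_subset_nearQ hkR)
    (S.isTarget_halving hk hR hRlh hfit0) (S.Bk_subset_nearQ hkR1) (S.Bk_nonempty _ _) hB

/-- **The halving chain, linear form** (tree `CData.halvingChain_of_target`): `n` halving steps from `B_k` to
`B_{k+n}` (`k + n ≤ d`) cost `n·η`.
builds on p205010 (kernel theorem, internal audit signed; external expert review pending).
[cite: KozmaNitzan2024, §4 p. 24 ("We continue this way, each time halving one dimension")] -/
theorem halvingChain_linear [NeZero d] (p : unitInterval) {η : ℝ} {R₀ : ℕ}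
    (hT : ∀ δ' : ℝ, TargetPropertyAt d p (δ' + η) δ' (qfList d) R₀) (n : ℕ) :
    ∀ (S : CData d), S.Hyp p → ∀ (k R : ℕ), k + n ≤ d → R₀ ≤ R → R₀ ≤ S.lh →
      ((S.r + 1) / 2 : ℕ) + (d : ℤ) * R + R ≤ S.r → ∀ {δ' : ℝ},
      1 - δ' < (prodBernoulli (restrW (↑S.Aset : Set (Site d)) S.W)).real (⋃ b ∈ S.Bk k R, openConn S.o b) →
        1 - (δ' + n * η) < (prodBernoulli (restrW (↑S.Aset : Set (Site d)) S.W)).real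
          (⋃ b ∈ S.Bk (k + n) R, openConn S.o b) := by
  induction n with
  | zero =>
    intro S _ k R _ _ _ _ δ' hB
    simpa using hB
  | succ n ih =>
    intro S hS k R hkn hR hRlh hfit δ' hB
    have hfitk : ((S.r + 1) / 2 : ℕ) + (k : ℤ) * R + R ≤ S.r := by
      have : (k : ℤ) * R ≤ (d : ℤ) * R :=
        mul_le_mul_of_nonneg_right (by exact_mod_cast (by omega : k ≤ d)) (by positivity)
      linarith
    have step := halvingStep_linear p hT S hS k R (by omega) hR hRlh hfitk hB
    have rest := ih S hS (k + 1) R (by omega) hR hRlh hfit step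
    have e : k + 1 + n = k + (n + 1) := by ring
    have e' : δ' + η + (n : ℝ) * η = δ' + ((n + 1 : ℕ) : ℝ) * η := by push_cast; ring
    rw [e, e'] at rest
    exact rest

/-- **The corridor step, linear form** (tree `CData.corridorStep_of_target`, same geometric inputs): with a
linear family of target properties for the aspect-`88` elongated geometries (margin `R₀'`, loss `η'`), reaching
the small cube `B_d` from `o` in `U` with probability `> 1 − δ'` forces reaching `c' + [-2r,2r]^d` in `U` with
probability `> 1 − (δ' + η')`.
builds on p205010 (kernel theorem, internal audit signed; external expert review pending).
[cite: KozmaNitzan2024, §4 pp. 24–25] -/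
theorem corridorStep_linear [NeZero d] (p : unitInterval) {η' : ℝ} {R₀' : ℕ}
    (hT : ∀ δ' : ℝ, TargetPropertyAt d p (δ' + η') δ' (elongList d 88 (by norm_num)) R₀')
    (S : CData d) (hS : S.Hyp p) (R : ℕ) (h44 : 44 ≤ S.r) (hRc : 5 * R₀' + 5 ≤ S.r)
    (hΔ : 4 * ((S.lh : ℤ) + d * R + R₀') + 4 ≤ 7 * S.r) {δ' : ℝ}
    (hB : 1 - δ' < (prodBernoulli (restrW (↑S.Uset : Set (Site d)) S.W)).real (⋃ b ∈ S.Bk d R, openConn S.o b)) :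
    1 - (δ' + η') < (prodBernoulli (restrW (↑S.Uset : Set (Site d)) S.W)).real
      (⋃ b ∈ S.Tn (2 * S.r), openConn S.o b) := by
  -- `B_d⟨R₀'⟩ ⊆ Dcorr` and `Tn (2r) ⊆ Dcorr`
  have hw : ∀ i, S.hwid d R i = S.lh + d * R := fun i => by rw [S.hwid_apply, if_pos i.2]
  have hRc' : 5 * (R₀' : ℤ) + 5 ≤ S.r := by exact_mod_cast hRc
  have hencl : Finset.Icc (S.c - S.hwid d R - (R₀' : Site d)) (S.c + S.hwid d R + (R₀' : Site d)) ⊆ S.Dcorr := by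
    intro x hx
    rw [mem_Icc_iff] at hx
    simp only [Pi.sub_apply, Pi.add_apply, Pi.natCast_apply] at hx
    rw [S.mem_Dcorr_iff]
    have hlh : (0 : ℤ) ≤ S.lh := by positivity
    refine ⟨?_, fun j hj => ?_⟩
    · have := hx S.a; rw [hw] at this
      have hb := level_bounds_of_abs_le S.hσ (x := S.c S.a) (y := x S.a) (ℓ := S.lh + d * R + R₀')
        (by linarith) (by linarith)
      have e : S.σ * (x S.a - S.c S.a) = S.σ * x S.a - S.σ * S.c S.a := by ring
      rw [e]; constructor <;> linarith [hb.1, hb.2]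
    · have := hx j; rw [hw] at this
      constructor <;> linarith [this.1, this.2]
  have hTD : S.Tn (2 * S.r) ⊆ S.Dcorr := by
    intro x hx
    rw [S.mem_Tn_iff] at hx
    rw [S.mem_Dcorr_iff]
    push_cast at hx
    refine ⟨⟨by linarith [hx.1.1], by linarith [hx.1.2]⟩, fun j hj => ?_⟩
    have := hx.2 j hj
    constructor <;> linarith [this.1, this.2]
  exact hT δ' (restrW (↑S.Uset : Set (Site d)) S.W) S.Uset S.Dcorr (S.c - S.hwid d R) (S.c + S.hwid d R)
    (S.Tn (2 * S.r)) S.o (finSupp_restrW S.Uset S.W)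
    ((CData.isSubbox_Dcorr hS).restrW (Finset.coe_subset.2 (CData.Dcorr_subset_Uset hS)))
    (CData.Dcorr_subset_Uset hS) (Finset.mem_union_left _ (CData.o_mem_Aset hS)) (CData.o_not_mem_Dcorr hS) hencl
    (S.isTarget_corridor h44 hRc hΔ) hTD (S.Tn_nonempty _) hB

/-- **Kozma–Nitzan's Lemma 12 with LINEAR loss and explicit scale threshold.**  Given linear families of target
properties for the quarter faces (margin `R₀`, loss `η`) and for the aspect-`88` elongated geometries (margin
`R₀'`, loss `η'`), for every corridor datum `S` at parameter `p` (`S.Hyp p`) of scale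
`S.r ≥ 100(d+1)(max R₀ R₀' + 1)`:
`1 − δ' < P_W(o ↔ c + [-3r,3r]^d in A) ⟹ 1 − (δ' + d·η + η') < P_W(o ↔ c' + [-3r,3r]^d in U)`
(tree `CData.corridorLemma_of_target`: `d` halving steps in `A`, one corridor step in `U`; here the losses add).
builds on p205010 (kernel theorem, internal audit signed; external expert review pending).
[cite: KozmaNitzan2024, §4 Lemma 12 (pp. 23–25)] -/
theorem corridorLemma_linear [NeZero d] (p : unitInterval) {η η' : ℝ} {R₀ R₀' : ℕ}
    (hT : ∀ δ' : ℝ, TargetPropertyAt d p (δ' + η) δ' (qfList d) R₀)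
    (hT' : ∀ δ' : ℝ, TargetPropertyAt d p (δ' + η') δ' (elongList d 88 (by norm_num)) R₀')
    (S : CData d) (hS : S.Hyp p) (hm : 100 * (d + 1) * (max R₀ R₀' + 1) ≤ S.r) {δ' : ℝ}
    (hA : 1 - δ' < (prodBernoulli S.W).real
      (⋃ b ∈ Finset.Icc (S.c - ((3 * S.r : ℕ) : Site d)) (S.c + ((3 * S.r : ℕ) : Site d)),
        openConnIn (↑S.Aset : Set (Site d)) S.o b)) :
    1 - (δ' + d * η + η') < (prodBernoulli S.W).real
      (⋃ b ∈ S.Tn (3 * S.r), openConnIn (↑S.Uset : Set (Site d)) S.o b) := by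
  set R : ℕ := max R₀ R₀' with hRdef
  -- arithmetic
  have hR1 : R₀' ≤ R := le_max_right _ _
  have hR2 : R₀ ≤ R := le_max_left _ _
  have hm' : 100 * ((d : ℤ) + 1) * (R + 1) ≤ S.r := by exact_mod_cast hm
  have hd0 : (0 : ℤ) ≤ d := by positivity
  have hR0 : (0 : ℤ) ≤ R := by positivity
  have hdR : (0 : ℤ) ≤ d * R := by positivity
  have hexp : 100 * ((d : ℤ) + 1) * (R + 1) = 100 * (d * R) + 100 * d + 100 * R + 100 := by ring
  have hlh := S.two_lh
  have hhalf' : (((S.r + 1) / 2 : ℕ) : ℤ) + (S.r : ℤ) = S.lh := by unfold CData.lh; push_cast; ring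
  have hRc' : (R₀' : ℤ) ≤ R := by exact_mod_cast hR1
  have hRh' : (R₀ : ℤ) ≤ R := by exact_mod_cast hR2
  -- into the restricted weighting on `A`
  have ho : S.o ∈ (↑S.Aset : Set (Site d)) := Finset.mem_coe.2 (CData.o_mem_Aset hS)
  have h0 : 1 - δ' < (prodBernoulli (restrW (↑S.Aset : Set (Site d)) S.W)).real (⋃ b ∈ S.Bk 0 R, openConn S.o b) := by
    rw [S.Bk_zero, ← Finset.set_biUnion_coe, prodBernoulli_restrW_real_biUnion_openConn S.W _ ho,
      Finset.set_biUnion_coe]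
    exact hA
  -- the halving chain
  have h1 := halvingChain_linear p hT d S hS 0 R (by omega) hR2 ?_ ?_ h0
  rotate_left
  · have : (R : ℤ) ≤ S.lh := by linarith
    have : (R₀ : ℤ) ≤ S.lh := by linarith
    exact_mod_cast this
  · have hdRh : (d : ℤ) * R ≤ d * R := le_rfl
    linarith
  rw [zero_add] at h1
  -- from `A` to `U`
  have hoU : S.o ∈ (↑S.Uset : Set (Site d)) := Finset.mem_coe.2 (S.Aset_subset_Uset (CData.o_mem_Aset hS))
  have h2 : 1 - (δ' + d * η) < (prodBernoulli (restrW (↑S.Uset : Set (Site d)) S.W)).real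
      (⋃ b ∈ S.Bk d R, openConn S.o b) := by
    rw [← Finset.set_biUnion_coe, prodBernoulli_restrW_real_biUnion_openConn S.W _ hoU]
    rw [← Finset.set_biUnion_coe, prodBernoulli_restrW_real_biUnion_openConn S.W _ ho] at h1
    exact h1.trans_le (measureReal_mono (biUnion_openConnIn_mono (Finset.coe_subset.2 S.Aset_subset_Uset) S.o subset_rfl)
      (measure_ne_top _ _))
  -- the corridor step
  have h3 := corridorStep_linear p hT' S hS R ?_ ?_ ?_ h2
  rotate_left
  · have : (44 : ℤ) ≤ S.r := by linarith
    exact_mod_cast this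
  · have : 5 * (R₀' : ℤ) + 5 ≤ S.r := by linarith
    exact_mod_cast this
  · have : (d : ℤ) * R₀' ≤ d * R := mul_le_mul_of_nonneg_left hRc' hd0
    nlinarith
  -- back to `W`, and the larger target cube
  rw [← Finset.set_biUnion_coe, prodBernoulli_restrW_real_biUnion_openConn S.W _ hoU] at h3
  rw [← Finset.set_biUnion_coe]
  have e : δ' + (d : ℝ) * η + η' = δ' + d * η + η' := rfl
  refine h3.trans_le (measureReal_mono (biUnion_openConnIn_mono subset_rfl S.o (Finset.coe_subset.2 ?_))
    (measure_ne_top _ _))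
  intro x hx
  rw [S.mem_Tn_iff] at hx ⊢
  push_cast at hx ⊢
  refine ⟨⟨by linarith [hx.1.1], by linarith [hx.1.2]⟩, fun j hj => ?_⟩
  have := hx.2 j hj
  constructor <;> linarith [this.1, this.2]

end Summit.CriticalPhenomena.PercolationContinuityZ3.Theorems.Quant

end
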